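import Literature.Analysis.FluidPDE.GalerkinSmoothFamilies
import Literature.Analysis.FluidPDE.PassiveScalarWellPosednessProofs
import HarnessLib

/-!
# Smooth short-time solutions by the Fourier–Galerkin energy method, VI: the synthesized limit is
# a smooth solution

Analysis/FluidPDE proof file (theorems only), sequel of `GalerkinSmoothFamilies.lean`. From the
Fourier-side data of parts III–V (a real, divergence-free coefficient curve `c` on `[0, T]` with
every decay, solving mode by mode `∂ₜc_k = -ν4π²|k|²c_k + Π_k(-σ_kc_k - N(c)_k)`, and its
coefficient families of all orders) this file synthesizes the **smooth solution**: the real fields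
`θ_l(t,x) = Re ∑ₖ c(t)_{k,l} e_k(x)` and the pressure `q = Re ∑ₖ q̂(t)_k e_k`,
`q̂_k = -(k·N(c(t))_k)/(2πi|k|²)`, are jointly smooth on `[0,T] × T^d`
(`ScalarFourier.isSmoothSpaceTimeOn_torusSynth`) and satisfy, component by component,
`∂ₜθ_l + ∑ⱼ θⱼ∂ⱼθ_l + ∂_l q - νΔθ_l + Re ∑ₖ σ_k c(t)_{k,l} e_k = 0`, `∑_l ∂_lθ_l = 0`, `∫ q(t) = 0`
(`synthesized_solution`; Majda–Bertozzi 2002, Thm. 3.4: the limit is a classical solution — here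
read off on the Fourier side exactly as the tree's
`Torus.exists_isClassicalScalarTransportForcedOn`: the continuous defect has vanishing Fourier
coefficients, Grafakos 2014, Prop. 3.2.4, the pressure symbol cancelling the gradient part of the
Leray-projected right-hand side; realness from the conjugate symmetry of `c`).

The damping term is kept on the Fourier side (`σ = 0`: Euler/Navier–Stokes; `σ = ν'(2π|k|)^{2γ}`:
the fractional dissipation `ν'(-Δ)^γ`, identified with `Torus.fracLaplacian` in the sequel).

## References

* A. J. Majda, A. L. Bertozzi, *Vorticity and Incompressible Flow*, CUP 2002, §3.2, Thm. 3.4.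
  [`MajdaBertozziCUP2002`]
* L. Grafakos, *Classical Fourier Analysis*, 3rd ed., Springer 2014, Prop. 3.2.4 (uniqueness of
  Fourier coefficients). [`Grafakos2014`]
-/

noncomputable section

open MeasureTheory Set Filter Topology Function UnitAddTorus Metric Complex
open scoped ENNReal NNReal InnerProductSpace ContDiff ComplexConjugate

namespace Literature.Analysis.FluidPDE

namespace GalerkinSmooth

open FunctionSpaces FunctionSpaces.Torus Torus EulerGalerkin
open FourierNS (HasDecay)
open ScalarFourier (lconv dsym transportSym transportFamily latOrder latMass IsCoeffFamily torusSynth)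

variable {d : Type*} [Fintype d] [DecidableEq d]

/-! ## Real synthesized fields -/

section Real

omit [DecidableEq d] in
/-- **The synthesis of a conjugate-symmetric summable family is real**:
`conj (∑ₖ bₖ e_k(x)) = ∑ₖ bₖ e_k(x)` when `b(-k) = conj b(k)`. [folklore] -/
theorem conj_tsum_mul_mFourier {b : (d → ℤ) → ℂ} (hb : ∀ m, b (-m) = conj (b m)) (x : UnitAddTorus d) :
    conj (∑' m, b m * mFourier m x) = ∑' m, b m * mFourier m x := by
  rw [Complex.conj_tsum]
  have h : ∀ m, conj (b m * mFourier m x) = b (-m) * mFourier (-m) x := fun m => by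
    rw [map_mul, hb m, mFourier_neg]
  simp_rw [h]
  exact (Equiv.neg (d → ℤ)).tsum_eq (fun m => b m * mFourier m x)

end Real

/-! ## The smooth solution synthesized from the Galerkin limit -/

section Solution

variable {ν : ℝ} {σ : (d → ℤ) → ℝ} {T : ℝ} {c : ℝ → (d → ℤ) → EuclideanSpace ℂ d}

set_option maxHeartbeats 1600000 in
/-- **The synthesized Galerkin limit is a smooth solution** (Majda–Bertozzi 2002, Thm. 3.4: the
limit is a classical solution; here read off on the Fourier side as in the tree's
`Torus.exists_isClassicalScalarTransportForcedOn`). Let `c : [0,T] → (ℤ^d → ℂ^d)` be real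
(`IsConjSymm`), divergence free, continuous at each mode with every decay, and solve mode by mode
`∂ₜc_k = -ν4π²|k|²c_k + Π_k(-σ_kc_k - N(c)_k)` within `[0,T]` (`T > 0`, `ν ≥ 0`, `σ ≥ 0` of at most
quadratic growth). Then the real fields `v_l(t,x) = Re ∑ₖ c(t)_{k,l} e_k(x)` and the pressure
`q(t,x) = Re ∑ₖ q̂(t)_k e_k(x)`, `q̂_k = -(k·N(c(t))_k)/(2πi|k|²)`, are jointly smooth on
`[0,T] × T^d` and satisfy, component by component,
`∂ₜv_l + ∑ⱼ vⱼ∂ⱼv_l + ∂_l q - νΔv_l + Re ∑ₖ σ_k c(t)_{k,l} e_k = 0`, `div v = 0`, `∫ q(t) = 0`,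
and `𝓕(v(t))_k = c(t)_k`. [cite: MajdaBertozziCUP2002, Thm. 3.4] -/
theorem synthesized_solution (hT : 0 < T) (hν : 0 ≤ ν) (hσ : ∀ k, 0 ≤ σ k) {Mσ : ℝ} (hMσ : 0 ≤ Mσ)
    (hσg : ∀ k, σ k ≤ Mσ * (1 + ‖k‖) ^ 2)
    (hconj : ∀ t ∈ Icc 0 T, IsConjSymm (c t))
    (htrans : ∀ t ∈ Icc 0 T, ∀ k : d → ℤ, ∑ j, (k j : ℂ) * c t k j = 0)
    (hdec : ∀ K : ℕ, ∃ C : ℝ, ∀ t ∈ Icc 0 T, HasDecay K C (c t))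
    (hcont : ∀ k, ContinuousOn (fun t => c t k) (Icc 0 T))
    (hode : ∀ k, ∀ t ∈ Icc 0 T, HasDerivWithinAt (fun s => c s k)
      (-((((ν * (4 * Real.pi ^ 2 * freqNormSq k)) : ℝ) : ℂ) • c t k) +
        leraySym k (-((((σ k) : ℝ)) : ℂ) • c t k -
          WithLp.toLp 2 (fun p => transportSym (fun j m => c t m j) (fun m => c t m p) k))) (Icc 0 T) t) :
    ∃ (θ : d → ℝ → UnitAddTorus d → ℝ) (q : ℝ → UnitAddTorus d → ℝ),
      (∀ l, FunctionSpaces.Torus.IsSmoothSpaceTimeOn (Icc 0 T) (θ l)) ∧ FunctionSpaces.Torus.IsSmoothSpaceTimeOn (Icc 0 T) q ∧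
      (∀ t ∈ Icc 0 T, ∀ x, ∀ l : d,
        FunctionSpaces.Torus.timeDerivWithin (Icc 0 T) (θ l) t x + ∑ j, θ j t x * Torus.partialDeriv j (θ l t) x +
          Torus.partialDeriv l (q t) x - ν * FunctionSpaces.Torus.laplacian (θ l t) x +
          (∑' m, ((σ m : ℝ) : ℂ) * c t m l * mFourier m x).re = 0) ∧
      (∀ t ∈ Icc 0 T, ∀ x, ∑ l, Torus.partialDeriv l (θ l t) x = 0) ∧
      (∀ t ∈ Icc 0 T, FunctionSpaces.Torus.HasZeroMean (q t)) ∧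
      (∀ t ∈ Icc 0 T, ∀ x, ∀ l : d, ((θ l t x : ℝ) : ℂ) = ∑' m, c t m l * mFourier m x) := by
  have hS : UniqueDiffOn ℝ (Icc 0 T) := uniqueDiffOn_Icc hT
  -- families of all orders for each component
  have hfam : ∀ n, ∃ W : ℕ → ℝ → (d → ℤ) → EuclideanSpace ℂ d, W 0 = c ∧
      ∀ l, IsCoeffFamily T n (fun i t m => W i t m l) := fun n =>
    exists_vectorCoeffFamily hT hν hσ hMσ hσg hdec hcont htrans hode n
  have hfaml : ∀ l n, ∃ W : ℕ → ℝ → (d → ℤ) → ℂ, W 0 = (fun t m => c t m l) ∧ IsCoeffFamily T n W := by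
    intro l n
    obtain ⟨W, hW0, hW⟩ := hfam n
    exact ⟨fun i t m => W i t m l, by funext t m; simp [hW0], hW l⟩
  -- the complex components and their real parts
  set Θ : d → ℝ → UnitAddTorus d → ℂ := fun l => torusSynth (fun t m => c t m l) with hΘdef
  have hΘs : ∀ l, FunctionSpaces.Torus.IsSmoothSpaceTimeOn (Icc 0 T) (Θ l) := fun l =>
    ScalarFourier.isSmoothSpaceTimeOn_torusSynth hT (hfaml l)
  have hΘapply : ∀ l t x, Θ l t x = ∑' m, c t m l * mFourier m x := fun l t x => rfl
  -- decay and summability bookkeeping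
  have hdecl : ∀ t ∈ Icc 0 T, ∀ l, ∃ C, HasDecay (latOrder d) C (fun m => c t m l) := fun t ht l => by
    obtain ⟨C, hC⟩ := hdec (latOrder d); exact ⟨C, hasDecay_apply (hC t ht) l⟩
  have hsuml : ∀ t ∈ Icc 0 T, ∀ l, Summable fun m => ‖c t m l‖ := fun t ht l => by
    obtain ⟨C, hC⟩ := hdecl t ht l; exact ScalarFourier.summable_norm_of_hasDecay le_rfl hC
  -- realness of the components
  have hreal : ∀ t ∈ Icc 0 T, ∀ x l, ((Θ l t x).re : ℂ) = Θ l t x := by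
    intro t ht x l
    refine Complex.conj_eq_iff_re.mp ?_
    rw [hΘapply]
    exact conj_tsum_mul_mFourier (fun m => by
      have h := hconj t ht m
      rw [h, FunctionSpaces.EuclideanSpace.conjVec_apply]) x
  have hcoefΘ : ∀ t ∈ Icc 0 T, ∀ l k, mFourierCoeff (Θ l t) k = c t k l := fun t ht l k =>
    ScalarFourier.mFourierCoeff_tsum_mul_mFourier (hsuml t ht l) k
  -- the nonlinearity and the pressure coefficients
  set N : ℝ → (d → ℤ) → d → ℂ := fun t k p => transportSym (fun j m => c t m j) (fun m => c t m p) k with hNdef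
  set qh : ℝ → (d → ℤ) → ℂ := fun t k =>
    -(∑ p, (k p : ℂ) * N t k p) / (2 * Real.pi * Complex.I * ((freqNormSq k : ℝ) : ℂ)) with hqhdef
  -- the pressure coefficients start families of every order
  have hqfam : ∀ n, ∃ Q : ℕ → ℝ → (d → ℤ) → ℂ, Q 0 = qh ∧ IsCoeffFamily T n Q := by
    intro n
    obtain ⟨W, hW0, hW⟩ := hfam n
    refine ⟨fun i t k => ∑ p, (-((k p : ℂ)) / (2 * Real.pi * Complex.I * ((freqNormSq k : ℝ) : ℂ))) *
      transportFamily (fun j i' t' m => W i' t' m j) (fun i' t' m => W i' t' m p) i t k, ?_, ?_⟩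
    · funext t k
      simp only [ScalarFourier.transportFamily_zero, hW0, hqhdef, hNdef, Finset.sum_div, neg_div]
      rw [← Finset.sum_neg_distrib]
      refine Finset.sum_congr rfl fun p _ => ?_
      ring
    · refine IsCoeffFamily.finset_sum _ fun p _ => ?_
      refine ((hW p).transportFamily hT (fun j => hW j)).symbol (g := 0) (M := 1) zero_le_one fun k => ?_
      rw [pow_zero, mul_one, norm_div, norm_neg, Complex.norm_intCast]
      have hden : ‖(2 * Real.pi * Complex.I * ((freqNormSq k : ℝ) : ℂ) : ℂ)‖ = 2 * Real.pi * freqNormSq k := by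
        simp [abs_of_pos Real.pi_pos, abs_of_nonneg (freqNormSq_nonneg k)]
      rw [hden]
      by_cases h0 : freqNormSq k = 0
      · rw [h0, mul_zero, div_zero]; exact zero_le_one
      · have hpos : 0 < freqNormSq k := lt_of_le_of_ne (freqNormSq_nonneg k) (Ne.symm h0)
        rw [div_le_one (by positivity)]
        have hkp : |(k p : ℝ)| ^ 2 ≤ freqNormSq k := by
          rw [sq_abs]; exact Finset.single_le_sum (f := fun i => ((k i : ℝ)) ^ 2) (fun _ _ => sq_nonneg _) (Finset.mem_univ p)
        have hint : |(k p : ℝ)| ≤ |(k p : ℝ)| ^ 2 := by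
          rcases eq_or_ne (k p) 0 with hz | hz
          · simp [hz]
          · have h1 : (1 : ℝ) ≤ |(k p : ℝ)| := by
              rw [← Int.cast_abs]; exact_mod_cast Int.one_le_abs hz
            nlinarith
        have hk1 : |((k p : ℤ) : ℝ)| ≤ freqNormSq k := hint.trans hkp
        nlinarith [Real.pi_gt_three, abs_nonneg ((k p : ℤ) : ℝ)]
  set Q : ℝ → UnitAddTorus d → ℂ := torusSynth qh with hQdef
  have hQs : FunctionSpaces.Torus.IsSmoothSpaceTimeOn (Icc 0 T) Q := ScalarFourier.isSmoothSpaceTimeOn_torusSynth hT hqfam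
  set q : ℝ → UnitAddTorus d → ℝ := fun t x => (Q t x).re with hqdef
  have hqs : FunctionSpaces.Torus.IsSmoothSpaceTimeOn (Icc 0 T) q := hQs.clm_comp Complex.reCLM
  have hsumq : ∀ t ∈ Icc 0 T, Summable fun k => ‖qh t k‖ := by
    intro t ht
    obtain ⟨Qf, hQ0, hQf⟩ := hqfam 0
    obtain ⟨C, -, hC⟩ := hQf.decay_nonneg le_rfl (latOrder d)
    have h := ScalarFourier.summable_norm_of_hasDecay le_rfl (hC t ht)
    rwa [hQ0] at h
  have hcoefQ : ∀ t ∈ Icc 0 T, ∀ k, mFourierCoeff (Q t) k = qh t k := fun t ht k =>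
    ScalarFourier.mFourierCoeff_tsum_mul_mFourier (hsumq t ht) k
  -- the complex equation, component by component
  have hcomplex : ∀ t ∈ Icc 0 T, ∀ x, ∀ l : d, FunctionSpaces.Torus.timeDerivWithin (Icc 0 T) (Θ l) t x +
      ∑ j, Θ j t x * Torus.partialDeriv j (Θ l t) x + Torus.partialDeriv l (Q t) x -
        (ν : ℂ) * FunctionSpaces.Torus.laplacian (Θ l t) x + ∑' m, ((σ m : ℝ) : ℂ) * c t m l * mFourier m x = 0 := by
    intro t ht x l
    obtain ⟨W, hW0, hW⟩ := hfam 1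
    -- `W₁` is the right-hand side of the equation
    have hW1 : ∀ k, W 1 t k l = -((((ν * (4 * Real.pi ^ 2 * freqNormSq k)) : ℝ) : ℂ)) * c t k l -
        ((σ k : ℝ) : ℂ) * c t k l - N t k l + (∑ p, (k p : ℂ) * N t k p) / ((freqNormSq k : ℝ) : ℂ) * (k l : ℂ) := by
      intro k
      have h1 := (hW l).deriv 0 (by norm_num) k t ht
      simp only [hW0, zero_add] at h1
      have h2 := ((EuclideanSpace.proj (𝕜 := ℂ) (ι := d) l).restrictScalars ℝ).hasFDerivAt.comp_hasDerivWithinAt t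
        (hode k t ht)
      have h12 : W 1 t k l = (-((((ν * (4 * Real.pi ^ 2 * freqNormSq k)) : ℝ) : ℂ) • c t k) +
          leraySym k (-((((σ k) : ℝ)) : ℂ) • c t k -
            WithLp.toLp 2 (fun p => transportSym (fun j m => c t m j) (fun m => c t m p) k))) l :=
        (h1.derivWithin (hS t ht)).symm.trans (h2.derivWithin (hS t ht))
      rw [h12, PiLp.add_apply, PiLp.neg_apply, PiLp.smul_apply, smul_eq_mul, leraySym_apply]
      simp only [PiLp.sub_apply, PiLp.smul_apply, smul_eq_mul, hNdef]
      have htr := htrans t ht k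
      -- expand the Leray matrix
      simp only [sub_mul, Finset.sum_sub_distrib, ite_mul, one_mul, zero_mul, Finset.sum_ite_eq, Finset.mem_univ,
        if_true, mul_sub]
      have hsum0 : ∑ p, (k l : ℂ) * (k p : ℂ) / ((freqNormSq k : ℝ) : ℂ) * (((σ k : ℝ) : ℂ) * c t k p) = 0 := by
        have : ∑ p, (k l : ℂ) * (k p : ℂ) / ((freqNormSq k : ℝ) : ℂ) * (((σ k : ℝ) : ℂ) * c t k p) =
            (k l : ℂ) * ((σ k : ℝ) : ℂ) / ((freqNormSq k : ℝ) : ℂ) * ∑ p, (k p : ℂ) * c t k p := by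
          rw [Finset.mul_sum]; refine Finset.sum_congr rfl fun p _ => by ring
        rw [this, htr, mul_zero]
      rw [show (∑ p, (k l : ℂ) * (k p : ℂ) / ((freqNormSq k : ℝ) : ℂ) * (-(((σ k : ℝ) : ℂ)) * c t k p)) =
          -(∑ p, (k l : ℂ) * (k p : ℂ) / ((freqNormSq k : ℝ) : ℂ) * (((σ k : ℝ) : ℂ) * c t k p)) by
        rw [← Finset.sum_neg_distrib]; refine Finset.sum_congr rfl fun p _ => by ring, hsum0]
      rw [Finset.sum_div, Finset.sum_mul]
      have hre : ∑ p, (k l : ℂ) * (k p : ℂ) / ((freqNormSq k : ℝ) : ℂ) * transportSym (fun j m => c t m j) (fun m => c t m p) k =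
          ∑ p, (k p : ℂ) * transportSym (fun j m => c t m j) (fun m => c t m p) k / ((freqNormSq k : ℝ) : ℂ) * (k l : ℂ) :=
        Finset.sum_congr rfl fun p _ => by ring
      rw [hre]
      ring
    -- time derivative of `Θ l`
    have hdt : ∀ y, FunctionSpaces.Torus.timeDerivWithin (Icc 0 T) (Θ l) t y = torusSynth (fun t m => W 1 t m l) t y := by
      intro y
      have := ScalarFourier.timeDerivWithin_torusSynth hT (hW l) ht y
      simpa only [hW0] using this
    -- summabilities
    obtain ⟨C1, -, hC1⟩ := (hW l).decay_nonneg le_rfl (latOrder d)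
    have hsum1 : Summable fun m => ‖W 1 t m l‖ := ScalarFourier.summable_norm_of_hasDecay le_rfl (hC1 t ht)
    have hΘlt : FunctionSpaces.Torus.IsSmooth (Θ l t) := (hΘs l).isSmooth_slice ht
    have hΘjt : ∀ j, IsSmooth (Θ j t) := fun j => (hΘs j).isSmooth_slice ht
    have hQt : FunctionSpaces.Torus.IsSmooth (Q t) := hQs.isSmooth_slice ht
    -- the damping series is the equation's remainder, hence a continuous function; its coefficients
    have hsumσ : Summable fun m => ‖((σ m : ℝ) : ℂ) * c t m l‖ := by
      obtain ⟨C, hC⟩ := hdec (latOrder d + 2)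
      have hd := (hasDecay_apply (hC t ht) l).mul_growth (K := latOrder d) (d := 2) (m := fun m => ((σ m : ℝ) : ℂ)) hMσ
        (fun m => by rw [Complex.norm_real, Real.norm_of_nonneg (hσ m)]; exact hσg m)
      exact ScalarFourier.summable_norm_of_hasDecay le_rfl hd
    -- coefficients of all terms
    have hcdt : ∀ k, mFourierCoeff (FunctionSpaces.Torus.timeDerivWithin (Icc 0 T) (Θ l) t) k = W 1 t k l := fun k => by
      have : FunctionSpaces.Torus.timeDerivWithin (Icc 0 T) (Θ l) t = fun x => ∑' m, W 1 t m l * mFourier m x := funext fun y => by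
        rw [hdt y]; rfl
      rw [this]; exact ScalarFourier.mFourierCoeff_tsum_mul_mFourier hsum1 k
    have hcD : ∀ j k, mFourierCoeff (Torus.partialDeriv j (Θ l t)) k = dsym j k * c t k l := fun j k => by
      rw [FunctionSpaces.Torus.mFourierCoeff_partialDeriv hΘlt j k, hcoefΘ t ht l k, ScalarFourier.dsym_apply, smul_eq_mul]
    have hcΔ : ∀ k, mFourierCoeff (FunctionSpaces.Torus.laplacian (Θ l t)) k =
        -((4 * Real.pi ^ 2 * freqNormSq k : ℝ) : ℂ) * c t k l := fun k => by
      rw [ScalarFourier.mFourierCoeff_laplacian hΘlt, hcoefΘ t ht l k]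
    have hcP : ∀ j k, mFourierCoeff (fun x => Θ j t x * Torus.partialDeriv j (Θ l t) x) k =
        lconv (fun m => c t m j) (fun m => dsym j m * c t m l) k := fun j k => by
      rw [ScalarFourier.mFourierCoeff_mul (hΘjt j).continuous (by simpa only [hcoefΘ t ht j] using hsuml t ht j)
        (hΘlt.partialDeriv j).continuous]
      have h2 : (fun m => mFourierCoeff (Torus.partialDeriv j (Θ l t)) m) = fun m => dsym j m * c t m l := funext fun m => hcD j m
      rw [h2]
      simp only [hcoefΘ t ht j]
    have hcQ : ∀ k, mFourierCoeff (Torus.partialDeriv l (Q t)) k = dsym l k * qh t k := fun k => by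
      rw [FunctionSpaces.Torus.mFourierCoeff_partialDeriv hQt l k, hcoefQ t ht k, ScalarFourier.dsym_apply, smul_eq_mul]
    have hcσ : ∀ k, mFourierCoeff (fun x => ∑' m, ((σ m : ℝ) : ℂ) * c t m l * mFourier m x) k = ((σ k : ℝ) : ℂ) * c t k l :=
      fun k => ScalarFourier.mFourierCoeff_tsum_mul_mFourier hsumσ k
    -- the defect
    set E : UnitAddTorus d → ℂ := fun x => FunctionSpaces.Torus.timeDerivWithin (Icc 0 T) (Θ l) t x +
      ∑ j, Θ j t x * Torus.partialDeriv j (Θ l t) x + Torus.partialDeriv l (Q t) x -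
        (ν : ℂ) * FunctionSpaces.Torus.laplacian (Θ l t) x + ∑' m, ((σ m : ℝ) : ℂ) * c t m l * mFourier m x with hEdef
    have hAt : FunctionSpaces.Torus.IsSmooth (FunctionSpaces.Torus.timeDerivWithin (Icc 0 T) (Θ l) t) := ((hΘs l).timeDerivWithin hS).isSmooth_slice ht
    have hBc : Continuous fun x => ∑ j, Θ j t x * Torus.partialDeriv j (Θ l t) x :=
      continuous_finsetSum _ fun j _ => (hΘjt j).continuous.mul (hΘlt.partialDeriv j).continuous
    have hPc : Continuous (Torus.partialDeriv l (Q t)) := (hQt.partialDeriv l).continuous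
    have hCc' : Continuous fun x => (ν : ℂ) * FunctionSpaces.Torus.laplacian (Θ l t) x := continuous_const.mul hΘlt.laplacian.continuous
    have hDc : Continuous fun x => ∑' m, ((σ m : ℝ) : ℂ) * c t m l * mFourier m x :=
      continuous_tsum (fun m => continuous_const.mul (mFourier m).continuous) hsumσ
        fun m x => le_of_eq (ScalarFourier.norm_mul_mFourier _ m x)
    have hEc : Continuous E := (((hAt.continuous.add hBc).add hPc).sub hCc').add hDc
    have hEcoeff : ∀ k, mFourierCoeff E k = 0 := by
      intro k
      have hAi := hAt.continuous.integrable_unitAddTorus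
      have hBi := hBc.integrable_unitAddTorus
      have hPi := hPc.integrable_unitAddTorus
      have hCi := hCc'.integrable_unitAddTorus
      have hDi := hDc.integrable_unitAddTorus
      change mFourierCoeff ((((FunctionSpaces.Torus.timeDerivWithin (Icc 0 T) (Θ l) t + fun x => ∑ j, Θ j t x * Torus.partialDeriv j (Θ l t) x) +
        Torus.partialDeriv l (Q t)) - fun x => (ν : ℂ) * FunctionSpaces.Torus.laplacian (Θ l t) x) +
        fun x => ∑' m, ((σ m : ℝ) : ℂ) * c t m l * mFourier m x) k = 0
      rw [FunctionSpaces.Torus.mFourierCoeff_add (((hAi.add hBi).add hPi).sub hCi) hDi,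
        FunctionSpaces.Torus.mFourierCoeff_sub ((hAi.add hBi).add hPi) hCi,
        FunctionSpaces.Torus.mFourierCoeff_add (hAi.add hBi) hPi,
        FunctionSpaces.Torus.mFourierCoeff_add hAi hBi,
        FunctionSpaces.Torus.mFourierCoeff_finset_sum (f := fun j x => Θ j t x * Torus.partialDeriv j (Θ l t) x) _
          (fun j _ => ((hΘjt j).continuous.mul (hΘlt.partialDeriv j).continuous).integrable_unitAddTorus),
        Torus.mFourierCoeff_const_mul', hcdt, hcΔ, hcQ, hcσ, hW1 k]
      simp_rw [hcP]
      rw [show ∑ j, lconv (fun m => c t m j) (fun m => dsym j m * c t m l) k = N t k l by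
        simp only [hNdef, ScalarFourier.transportSym_apply]]
      -- the remaining algebra: the pressure cancels the gradient part of `W₁`
      set Sk : ℂ := ∑ p, (k p : ℂ) * N t k p with hSk
      set F : ℂ := ((freqNormSq k : ℝ) : ℂ) with hF
      have hI : (2 * (Real.pi : ℂ) * Complex.I : ℂ) ≠ 0 :=
        mul_ne_zero (mul_ne_zero two_ne_zero (by exact_mod_cast Real.pi_ne_zero)) Complex.I_ne_zero
      have hB : dsym l k * qh t k = -(Sk / F * (k l : ℂ)) := by
        simp only [hqhdef, ScalarFourier.dsym_apply]
        rw [← hSk, ← hF, mul_div_assoc', show 2 * (Real.pi : ℂ) * Complex.I * ((k l : ℤ) : ℂ) * -Sk =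
          -(Sk * ((k l : ℤ) : ℂ)) * (2 * (Real.pi : ℂ) * Complex.I) by ring,
          show 2 * (Real.pi : ℂ) * Complex.I * F = F * (2 * (Real.pi : ℂ) * Complex.I) by ring,
          mul_div_mul_right _ _ hI, neg_div, div_mul_eq_mul_div]
      rw [hB]
      push_cast
      ring
    -- hence `E = 0`
    have hae := FunctionSpaces.Torus.ae_eq_zero_of_forall_mFourierCoeff_eq_zero hEc.integrable_unitAddTorus hEcoeff
    have hE0 : E = 0 := (hEc.ae_eq_iff_eq volume continuous_const).1 hae
    have hx := congrFun hE0 x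
    simpa only [hEdef, Pi.zero_apply] using hx
  -- the real fields
  set θ : d → ℝ → UnitAddTorus d → ℝ := fun l t x => (Θ l t x).re with hθdef
  have hθs : ∀ l, FunctionSpaces.Torus.IsSmoothSpaceTimeOn (Icc 0 T) (θ l) := fun l => (hΘs l).clm_comp Complex.reCLM
  refine ⟨θ, q, hθs, hqs, fun t ht x l => ?_, fun t ht x => ?_, fun t ht => ?_, fun t ht x l => hreal t ht x l⟩
  · -- the real equation: real part of the complex one
    have hΘlt : FunctionSpaces.Torus.IsSmooth (Θ l t) := (hΘs l).isSmooth_slice ht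
    have hQt : FunctionSpaces.Torus.IsSmooth (Q t) := hQs.isSmooth_slice ht
    have h := congrArg Complex.re (hcomplex t ht x l)
    rw [Complex.zero_re] at h
    simp only [Complex.add_re, Complex.sub_re, Complex.re_sum, Complex.mul_re, Complex.ofReal_re, Complex.ofReal_im,
      zero_mul, sub_zero] at h
    have hre : ∀ j, (Θ j t x).im = 0 := fun j => by
      have := congrArg Complex.im (hreal t ht x j); simpa using this.symm
    simp only [hre, zero_mul, sub_zero] at h
    rw [Torus.timeDerivWithin_re (hΘs l) hS ht, Torus.laplacian_re hΘlt, Torus.partialDeriv_re hQt l x]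
    simp_rw [show ∀ j, Torus.partialDeriv j (θ l t) x = (Torus.partialDeriv j (Θ l t) x).re from
      fun j => Torus.partialDeriv_re hΘlt j x]
    simpa only [hθdef] using h
  · -- incompressibility: the coefficients of `∑_l ∂_l Θ_l` are `2πi (k·c) = 0`
    have hΘlt : ∀ l, IsSmooth (Θ l t) := fun l => (hΘs l).isSmooth_slice ht
    set D : UnitAddTorus d → ℂ := fun y => ∑ l, Torus.partialDeriv l (Θ l t) y with hDdef
    have hDc : Continuous D := continuous_finsetSum _ fun l _ => ((hΘlt l).partialDeriv l).continuous
    have hDcoeff : ∀ k, mFourierCoeff D k = 0 := by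
      intro k
      change mFourierCoeff (fun y => ∑ l, Torus.partialDeriv l (Θ l t) y) k = 0
      rw [FunctionSpaces.Torus.mFourierCoeff_finset_sum (f := fun l => Torus.partialDeriv l (Θ l t)) _
        (fun l _ => ((hΘlt l).partialDeriv l).continuous.integrable_unitAddTorus)]
      have h2 : ∀ l, mFourierCoeff (Torus.partialDeriv l (Θ l t)) k = dsym l k * c t k l := fun l => by
        rw [FunctionSpaces.Torus.mFourierCoeff_partialDeriv (hΘlt l) l k, hcoefΘ t ht l k, ScalarFourier.dsym_apply, smul_eq_mul]
      simp only [h2, ScalarFourier.dsym_apply]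
      have htr := htrans t ht k
      calc ∑ l, 2 * ↑Real.pi * Complex.I * ((k l : ℤ) : ℂ) * c t k l = 2 * ↑Real.pi * Complex.I * ∑ l, ((k l : ℤ) : ℂ) * c t k l := by
            rw [Finset.mul_sum]; refine Finset.sum_congr rfl fun l _ => by ring
        _ = 0 := by rw [htr, mul_zero]
    have hae := FunctionSpaces.Torus.ae_eq_zero_of_forall_mFourierCoeff_eq_zero hDc.integrable_unitAddTorus hDcoeff
    have hD0 : D = 0 := (hDc.ae_eq_iff_eq volume continuous_const).1 hae
    have hx := congrFun hD0 x
    simp only [hDdef, Pi.zero_apply] at hx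
    have h := congrArg Complex.re hx
    rw [Complex.re_sum, Complex.zero_re] at h
    simpa only [hθdef, Torus.partialDeriv_re (hΘlt _)] using h
  · -- zero mean of the pressure: `q̂(0) = 0`
    have hQt : FunctionSpaces.Torus.IsSmooth (Q t) := hQs.isSmooth_slice ht
    have h0 : mFourierCoeff (Q t) 0 = 0 := by
      rw [hcoefQ t ht 0]
      simp [hqhdef]
    have hint : ∫ x, Q t x = 0 := by
      rw [FunctionSpaces.Torus.mFourierCoeff_eq_integral_volume] at h0
      simpa [mFourier_zero] using h0
    change ∫ x, (Q t x).re = 0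
    have h1 : ∫ x, (Q t x).re = (∫ x, Q t x).re := integral_re hQt.integrable
    rw [h1, hint, Complex.zero_re]

end Solution

end GalerkinSmooth

end Literature.Analysis.FluidPDE
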